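import Summits.ValiantsHypothesis.ValiantsHypothesis.Theorems.ZeroOneTransfer.Negative.TopComponentFree
import Literature.Computability.AlgebraicComplexity.PermanentIrreducible
import Literature.Computability.AlgebraicComplexity.MonotoneStructure

/-!
# Route `DivisionGap`, crux `PerDivisionHard` (stmt-ValiantsHypothesis-5065) — vocabulary of the
line `pair-descent-jss-endpoint` (route-posited objects, D-0016 `<RouteSlug>Defs.lean`)

The line degenerates a cheap monotone pair `(per_n · h, h)` over `ℝ≥0` along the normal fan of the
Birkhoff polytope `B_n = Newt(per_n)`.  Its registered stubs (skeleton
`Cruxes/PerDivisionHard/Lines/pair-descent-jss-endpoint.lean`) and the helper files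
`Theorems/DivisionGapPerDivisionHardStub*.lean` share the following transparent definitions; they
are collected here so that every stub file and the final composition speak about THE SAME
declarations.  Nothing here asserts anything.

* `IsTorusHomogeneous h` — all monomials of `h` have the same row margins and the same column
  margins (`h` is a semi-invariant of the torus `x_ij ↦ s_i t_j x_ij`; the lineality space of `B_n`).
* `facePer G` — the face `F_G` of the Birkhoff polytope as a polynomial: the sum of the permutation
  monomials `x^{μ_σ}` (`permMonomial`, column-major as in `perPoly_eq_sum_monomial`) over the
  permutations `σ` lying inside the cell set `G ⊆ [n] × [n]`.
* `CutsOut w G` — the weight `w` exposes exactly the face `G`: a permutation lies inside `G` iff its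
  `w`-weight is maximal.
* `HasSingleGPart G w h u` — the top-`w` fibre of `h` (`topComponent w h`, initial forms are free over
  `ℝ≥0`: `ZeroOneTransfer.Negative.complexity_topComponent_le`) restricts to the single exponent
  vector `u` on `G`.
* `BlockV b k m`, `blockAdj b k m`, `placedBlock eR eC` — the block arsenal `G(b,k) ⊕ M₀`: the
  complete bipartite graph `K_{b,b}` with every edge subdivided by `2k` internal vertices (so its
  perfect matchings are in phase-bijection with those of `K_{b,b}` and its girth is `4(2k+1)`),
  padded by a perfect matching on `m` further vertices, placed into the `n × n` matrix by
  bijections of its row and column labels with `Fin n`.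

References: Jerrum–Snir 1982 (envelopes, §2; permanent §4.3), Jukna–Seiwert–Sergeev 2022 (monomial
cofactors), Hrubeš–Yehudayoff 2021 §6 (the normal form `f · h = g`).
-/

noncomputable section

-- `Summit.ValiantsHypothesis.ValiantsHypothesis.…` is the tree's mandated single-conjunct layout
-- (Sub = Summit), so the duplicated namespace component is intended.
set_option linter.dupNamespace false

namespace Summit.ValiantsHypothesis.ValiantsHypothesis.Theorems.DivisionGapPerDivisionHard

open MvPolynomial Literature.Computability.AlgebraicComplexity
open Summit.ValiantsHypothesis.ValiantsHypothesis.Theorems.ZeroOneTransfer.Negative (topComponent)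
open scoped NNReal

/-- Torus homogeneity of a polynomial in the matrix variables `x_ij`: all monomials of `h` have the
same vector of row margins (`rowDegrees`) and the same vector of column margins
(`Finsupp.mapDomain Prod.snd`); equivalently `h` is a semi-invariant of `x_ij ↦ s_i t_j x_ij`.
The zero polynomial is torus-homogeneous. [folklore] -/
def IsTorusHomogeneous {n : ℕ} (h : MvPolynomial (Fin n × Fin n) ℝ≥0) : Prop :=
  ∃ r c : Fin n →₀ ℕ, ∀ m ∈ h.support, rowDegrees m = r ∧ Finsupp.mapDomain Prod.snd m = c

/-- The face permanent `per_G` of a cell set `G ⊆ [n] × [n]`: the sum of the permutation monomials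
`x^{μ_σ}`, `μ_σ = Σ_i e_{(σ i, i)}` (`permMonomial σ`), over the permutations `σ` with all cells
`(σ i, i)` in `G` — the perfect-matching polynomial of the bipartite graph `G`, i.e. the face `F_G`
of the Birkhoff polytope `Newt(per_n)`. [folklore] -/
def facePer {n : ℕ} (G : Finset (Fin n × Fin n)) : MvPolynomial (Fin n × Fin n) ℝ≥0 :=
  ∑ σ ∈ (Finset.univ : Finset (Equiv.Perm (Fin n))).filter (fun σ => ∀ i, (σ i, i) ∈ G),
    monomial (permMonomial σ) (1 : ℝ≥0)

/-- Sanity link of the vocabulary with the tree: the face permanent of the FULL cell set is the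
permanent, `facePer univ = per_n` (`perPoly_eq_sum_monomial`). [folklore] -/
theorem facePer_univ : ∀ n : ℕ,
    facePer (Finset.univ : Finset (Fin n × Fin n)) = perPoly (Fin n) ℝ≥0 := by
  intro n
  classical
  rw [facePer, perPoly_eq_sum_monomial, Finset.filter_true_of_mem]
  intro σ _ i
  exact Finset.mem_univ _

/-- The weight `w` CUTS OUT the face `G`: a permutation lies inside `G` iff its `w`-weight
`Σ_i w (σ i, i)` is maximal among all permutations.  Under this condition the top-`w` component of
`per_n` is `facePer G` (and `G` contains a perfect matching). [folklore] -/
def CutsOut {n : ℕ} (w : Fin n × Fin n → ℕ) (G : Finset (Fin n × Fin n)) : Prop :=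
  ∀ σ : Equiv.Perm (Fin n),
    (∀ i, (σ i, i) ∈ G) ↔ ∀ τ : Equiv.Perm (Fin n), (∑ i, w (τ i, i)) ≤ ∑ i, w (σ i, i)

/-- The top-`w` fibre of `h` has the SINGLE `G`-part `u`: `u` is supported inside `G` and every
monomial of `topComponent w h` agrees with `u` on the cells of `G` (monomials of the fibre may
differ off `G`). [folklore] -/
def HasSingleGPart {n : ℕ} (G : Finset (Fin n × Fin n)) (w : Fin n × Fin n → ℕ)
    (h : MvPolynomial (Fin n × Fin n) ℝ≥0) (u : (Fin n × Fin n) →₀ ℕ) : Prop :=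
  u.support ⊆ G ∧ ∀ m ∈ (topComponent w h).support, ∀ e ∈ G, m e = u e

/-- Vertex labels of the block arsenal `G(b,k) ⊕ M₀` (the same type labels rows and columns):
`b` core vertices, `b·b·k` internal vertices `(i, j, t)` of the subdivided core edge `(i, j)`, and
`m` padding vertices. [folklore] -/
abbrev BlockV (b k m : ℕ) : Type := Fin b ⊕ ((Fin b × Fin b × Fin k) ⊕ Fin m)

/-- Adjacency (row label, column label) of `G(b,k) ⊕ M₀`.  The core edge `(i, j)` of `K_{b,b}`
becomes the path  row `i` — col `(i,j,0)` — row `(i,j,0)` — col `(i,j,1)` — … — row `(i,j,k-1)` —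
col `j`  with `2k` internal vertices and `2k+1` edges (for `k = 0`: the edge `(i, j)` itself);
padding vertex `t` is adjacent to padding vertex `t` only. [folklore] -/
def blockAdj (b k m : ℕ) : BlockV b k m → BlockV b k m → Bool
  | Sum.inl _, Sum.inl _ => decide (k = 0)
  | Sum.inl i, Sum.inr (Sum.inl ⟨i', _, t⟩) => decide (i = i' ∧ (t : ℕ) = 0)
  | Sum.inr (Sum.inl ⟨i, j, t⟩), Sum.inr (Sum.inl ⟨i', j', t'⟩) =>
      decide (i = i' ∧ j = j' ∧ ((t' : ℕ) = t ∨ (t' : ℕ) = t + 1))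
  | Sum.inr (Sum.inl ⟨_, j, t⟩), Sum.inl j' => decide (j = j' ∧ (t : ℕ) + 1 = k)
  | Sum.inr (Sum.inr t), Sum.inr (Sum.inr t') => decide (t = t')
  | _, _ => false

/-- The PLACED block graph: the cell `(r, c)` of the `n × n` matrix belongs to it iff the labels
`eR.symm r`, `eC.symm c` are adjacent in `G(b,k) ⊕ M₀` (so `n = b + b²k + m`). [folklore] -/
def placedBlock {b k m n : ℕ} (eR eC : BlockV b k m ≃ Fin n) : Finset (Fin n × Fin n) :=
  Finset.univ.filter fun e => blockAdj b k m (eR.symm e.1) (eC.symm e.2) = true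

/-! ### Newton-edge vocabulary of the union-bound form of the line (skeleton v5–v6)

The open stub of the line (`stub_edgeEntropy`) and the unconditional rung
`Theorems/DivisionGapPerDivisionHardSmallEdgeSum.lean` speak about EDGE PAIRS of `Newt(h)` and the
two-sided union-bound sum over their (row set, column set) signatures.  Transparent definitions,
verbatim the skeleton's (`Cruxes/PerDivisionHard/Lines/pair_descent_jss_endpoint.lean`, v5). -/

/-- The rows in which two exponent vectors differ. [folklore] -/
def diffRows {n : ℕ} (m₁ m₂ : (Fin n × Fin n) →₀ ℕ) : Finset (Fin n) :=
  Finset.univ.filter fun r => ∃ c, m₁ (r, c) ≠ m₂ (r, c)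

/-- The columns in which two exponent vectors differ. [folklore] -/
def diffCols {n : ℕ} (m₁ m₂ : (Fin n × Fin n) →₀ ℕ) : Finset (Fin n) :=
  Finset.univ.filter fun c => ∃ r, m₁ (r, c) ≠ m₂ (r, c)

/-- The cells in which two exponent vectors differ (the support of their difference). [folklore] -/
def diffCells {n : ℕ} (m₁ m₂ : (Fin n × Fin n) →₀ ℕ) : Finset (Fin n × Fin n) :=
  Finset.univ.filter fun e => m₁ e ≠ m₂ e

/-- A cell set is FITTABLE at block parameters `(b, k)` if some placement of `G(b,k) ⊕ M₀`
contains it — the placement-free form of "could lie inside the placed face"; for the support of a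
nonzero circulation this forces a union of whole subdivision paths (so `≥ 4k+2` rows and columns).
[folklore] -/
def Fittable {n : ℕ} (b k : ℕ) (S : Finset (Fin n × Fin n)) : Prop :=
  ∃ (m : ℕ) (eR eC : BlockV b k m ≃ Fin n), S ⊆ placedBlock eR eC

/-- `(m₁, m₂)` is an EDGE PAIR of `h`: `m₁ ≠ m₂` and some weight `w'` exposes a top fibre of `h`
containing both and SEGMENT-LIKE with respect to them (every monomial of the fibre agrees with
`m₁` wherever `m₁` and `m₂` agree) — e.g. the lattice points of an edge of `Newt(h)` through
`m₁, m₂`. [folklore] -/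
def IsEdgePair {n : ℕ} (h : MvPolynomial (Fin n × Fin n) ℝ≥0) (m₁ m₂ : (Fin n × Fin n) →₀ ℕ) :
    Prop :=
  m₁ ≠ m₂ ∧ ∃ w' : Fin n × Fin n → ℕ, m₁ ∈ (topComponent w' h).support ∧
    m₂ ∈ (topComponent w' h).support ∧
    ∀ p ∈ (topComponent w' h).support, ∀ e, m₁ e = m₂ e → p e = m₁ e

/-- The edge pairs of `h` differing in at least `t` rows and on a `(b,k)`-fittable cell set, as a
finset of ordered pairs. [folklore] -/
def edgePairs {n : ℕ} (h : MvPolynomial (Fin n × Fin n) ℝ≥0) (t b k : ℕ) :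
    Finset (((Fin n × Fin n) →₀ ℕ) × ((Fin n × Fin n) →₀ ℕ)) := by
  classical
  exact (h.support ×ˢ h.support).filter fun p =>
    IsEdgePair h p.1 p.2 ∧ t ≤ (diffRows p.1 p.2).card ∧ Fittable b k (diffCells p.1 p.2)

/-- The (row set, column set) SIGNATURES of the `(b,k)`-fittable edge pairs of `h` differing in
`≥ t` rows, with both sets of size `≤ N` (larger ones fit in no pair of `N`-sets).  The
bad-placement event of an edge pair depends on its signature only, so the union bound runs over
this finset. [folklore] -/
def edgeSigs {n : ℕ} (h : MvPolynomial (Fin n × Fin n) ℝ≥0) (t b k N : ℕ) :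
    Finset (Finset (Fin n) × Finset (Fin n)) :=
  ((edgePairs h t b k).image fun p => (diffRows p.1 p.2, diffCols p.1 p.2)).filter
    fun s => s.1.card ≤ N ∧ s.2.card ≤ N

/-- The two-sided union-bound sum of `h` at row threshold `t`, block parameters `(b, k)` and block
size `N`: over the signatures `(T_r, T_c)` of `edgeSigs h t b k N`, the number
`C(n - |T_r|, N - |T_r|) · C(n - |T_c|, N - |T_c|)` of pairs of `N`-sets of rows and columns
containing them. [folklore] -/
def edgeSum {n : ℕ} (h : MvPolynomial (Fin n × Fin n) ℝ≥0) (t b k N : ℕ) : ℕ :=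
  ∑ s ∈ edgeSigs h t b k N,
    (n - s.1.card).choose (N - s.1.card) * (n - s.2.card).choose (N - s.2.card)

end Summit.ValiantsHypothesis.ValiantsHypothesis.Theorems.DivisionGapPerDivisionHard

end
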